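import Summits.QuantumAdvantage.AdviceFreeQNC0.LinearSelections
import Summits.QuantumAdvantage.AdviceFreeQNC0.WindowLadderBlocks

/-!
# WALK QUOTIENT — the block-flip lemma Q (planner qa-qnc0-p2 g21, ROUND-21 (p2) §1; ask P2-21 (a); `--supports` crux
# `ManyReadersSqrtOdd` stmt-QuantumAdvantage-23109)

VERBATIM port (part 1/2) of `HOME/qa-qnc0-p2/line21/Sketch21.lean` (authored AND proved by the planner seat qn-p2 g21, farm rc 0,
0 sorry; landed by the prover seat qn-prover-3 g13; only this header and the one-line docstrings of the auxiliary lemmas are new, and the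
sketch's copy of `wtPrefix_zero` is replaced by the tree's `AdviceFreeQNC0.wtPrefix_zero`).  Contents:

* `label c u g` — the walk label of cut `g` at charge `c`, `(c + g + walkExp u g) mod 3` in `ZMod 3`; cut `g` is LIVE iff
  `label ≠ 0` (`live_iff_label_ne_zero`).
* `blockFlip u a b` — negate the bits with index in `[a, b)`.  **`blockFlipLabels_holds : BlockFlipLabels`** (Lemma Q): if cuts
  `a < b` are both ZERO cuts (`label = 0`) then flipping the block between them FIXES every label outside `[a, b]` and NEGATES
  (1 ↔ 2) every label inside (prefix-weight bookkeeping `prefix_left/mid/right` + `omega` modulo 3); hence the live set is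
  invariant (`blockFlipLive_holds`) and the game restricted to the coset `u ⊕ span{1_{[a,b)}}` is a pure parity-of-tests game
  with a FIXED live set (`blockFlipWin_holds`).  Verified exhaustively `n ≤ 12` by the planner (`line21/quotient_check.py`,
  73 756 flips) and audited by qa-qnc0-ref (R-21).
Part 2 (`WalkThreeCharge.lean`): the three-charge identity, the charge-averaged `2/3` law, the odd-one-out form T′.
WHAT THIS IS NOT: no bound on the dense residual (R5 / (W2)); instrument for cruxes 23109/23029; separation NOT moved.
-/

open Finset

namespace Summit.QuantumAdvantage.AdviceFreeQNC0

namespace Coset21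

/-- Walk label of cut `g` at charge `c`. -/
def label {n : ℕ} (c : ℕ) (u : Fin n → Bool) (g : ℕ) : ZMod 3 := ((c + g + walkExp u g : ℕ) : ZMod 3)

/-- Cut `g` is live at charge `c` iff its walk label is non-zero. -/
theorem live_iff_label_ne_zero {n : ℕ} (c : ℕ) (u : Fin n → Bool) (g : ℕ) :
    (c + g + walkExp u g) % 3 ≠ 0 ↔ label c u g ≠ 0 := by
  unfold label
  rw [ne_eq, ne_eq, ← ZMod.val_eq_zero, ZMod.val_natCast]

/-- Negate the bits with index in `[a, b)`. -/
def blockFlip {n : ℕ} (u : Fin n → Bool) (a b : ℕ) : Fin n → Bool :=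
  fun i => if a ≤ i.val ∧ i.val < b then !u i else u i

/-- **Block-flip lemma** (support, S).  Between two ZERO cuts `a < b ≤ n`, flipping the block `[a,b)` fixes the labels of the
cuts `g ≤ a` and `g ≥ b` and negates the labels of the cuts `a ≤ g ≤ b`.  (Proof sketch: `label (g+1) − label g = 1 + u_g`;
`label b − label a = (b−a) + wt(block) ≡ 0`, so `wt u ≡ wt (flip u) (mod 3)`; inside, `(g−a) + P` and `2(g−a) − P` sum to
`3(g−a)`.) -/
def BlockFlipLabels : Prop :=
  ∀ (n c : ℕ) (u : Fin n → Bool) (a b : ℕ), a < b → b ≤ n → label c u a = 0 → label c u b = 0 →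
    (∀ g : ℕ, g ≤ a ∨ b ≤ g → label c (blockFlip u a b) g = label c u g) ∧
    (∀ g : ℕ, a ≤ g → g ≤ b → label c (blockFlip u a b) g = - label c u g)

/-- The live set is invariant under complete-block flips. -/
def BlockFlipLive : Prop :=
  ∀ (n c : ℕ) (u : Fin n → Bool) (a b : ℕ), a < b → b ≤ n → label c u a = 0 → label c u b = 0 →
    ∀ g : ℕ, (label c (blockFlip u a b) g ≠ 0 ↔ label c u g ≠ 0)

/-- `BlockFlipLabels → BlockFlipLive`: negation preserves non-vanishing. -/
theorem blockFlipLive_of_labels (h : BlockFlipLabels) : BlockFlipLive := by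
  intro n c u a b hab hbn ha hb g
  obtain ⟨hout, hin⟩ := h n c u a b hab hbn ha hb
  by_cases hg : g ≤ a ∨ b ≤ g
  · rw [hout g hg]
  · push Not at hg
    rw [hin g hg.1.le hg.2.le, neg_ne_zero]

/-- On a flipped input the game is the parity, over the ORIGINAL live set, of the strategy's values at the flipped input. -/
def BlockFlipWin : Prop :=
  ∀ (n c : ℕ) (y : Fin (n + 1) → (Fin n → Bool) → Bool) (u : Fin n → Bool) (a b : ℕ), a < b → b ≤ n →
    label c u a = 0 → label c u b = 0 →
    ringWinU c y (blockFlip u a b) =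
      decide ((univ.filter fun g : Fin (n + 1) =>
        y g (blockFlip u a b) = true ∧ (c + g.val + walkExp u g.val) % 3 ≠ 0).card % 2 = 1)

/-- `BlockFlipLive → BlockFlipWin`: the live set of the flipped input is the original one. -/
theorem blockFlipWin_of_live (h : BlockFlipLive) : BlockFlipWin := by
  intro n c y u a b hab hbn ha hb
  unfold ringWinU
  have hfilter : (univ.filter fun g : Fin (n + 1) =>
        y g (blockFlip u a b) = true ∧ (c + g.val + walkExp (blockFlip u a b) g.val) % 3 ≠ 0)
      = (univ.filter fun g : Fin (n + 1) =>
        y g (blockFlip u a b) = true ∧ (c + g.val + walkExp u g.val) % 3 ≠ 0) := by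
    apply Finset.filter_congr
    intro g _
    rw [live_iff_label_ne_zero, live_iff_label_ne_zero, h n c u a b hab hbn ha hb g.val]
  rw [hfilter]

/-! #### Proof of the block-flip lemma (prefix-weight bookkeeping + `omega` modulo 3) -/

/-- `(x : ZMod 3) = 0 ↔ x ≡ 0 (mod 3)`. -/
theorem natCast_zmod3_eq_zero_iff (x : ℕ) : (x : ZMod 3) = 0 ↔ x % 3 = 0 := by
  rw [← ZMod.val_eq_zero, ZMod.val_natCast]

/-- The total weight is the prefix weight at `n`. -/
theorem wt_eq_wtPrefix {n : ℕ} (v : Fin n → Bool) : wt v = wtPrefix v n := by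
  unfold wt wtPrefix
  congr 1
  ext i
  simp

-- `wtPrefix_zero` (the empty prefix has weight `0`) is the tree's `AdviceFreeQNC0.wtPrefix_zero` (WindowLadderBlocks.lean).

/-- Prefix-weight recursion: `W_{g+1} = W_g + [v_g]`. -/
theorem wtPrefix_succ {n : ℕ} (v : Fin n → Bool) (g : ℕ) (hg : g < n) :
    wtPrefix v (g + 1) = wtPrefix v g + (if v ⟨g, hg⟩ = true then 1 else 0) := by
  unfold wtPrefix
  rw [Finset.card_filter, Finset.card_filter]
  have hpt : ∀ i : Fin n, (if (i.val < g + 1 ∧ v i = true) then 1 else 0)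
      = (if (i.val < g ∧ v i = true) then 1 else 0) + (if (i.val = g ∧ v i = true) then 1 else 0) := by
    intro i
    by_cases hv : v i = true
    · simp only [hv, and_true]
      split_ifs <;> omega
    · simp [hv]
  rw [Finset.sum_congr rfl fun i _ => hpt i, Finset.sum_add_distrib]
  congr 1
  rw [Finset.sum_eq_single ⟨g, hg⟩]
  · simp
  · intro i _ hi
    have : i.val ≠ g := fun h => hi (Fin.ext h)
    simp [this]
  · intro h
    exact absurd (Finset.mem_univ _) h

/-- Inside the block the bit is negated. -/
theorem blockFlip_in {n : ℕ} (u : Fin n → Bool) (a b : ℕ) (i : Fin n) (h1 : a ≤ i.val) (h2 : i.val < b) :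
    blockFlip u a b i = !u i := by
  simp [blockFlip, h1, h2]

/-- Outside the block the bit is unchanged. -/
theorem blockFlip_out {n : ℕ} (u : Fin n → Bool) (a b : ℕ) (i : Fin n) (h : ¬ (a ≤ i.val ∧ i.val < b)) :
    blockFlip u a b i = u i := by
  simp only [blockFlip]
  rw [if_neg h]

/-- `[¬x] + [x] = 1`. -/
theorem ite_not_add (x : Bool) : (if (!x) = true then 1 else 0) + (if x = true then 1 else 0) = 1 := by
  cases x <;> simp

/-- prefix weights agree left of the block -/
theorem prefix_left {n : ℕ} (u : Fin n → Bool) (a b : ℕ) :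
    ∀ g, g ≤ a → g ≤ n → wtPrefix (blockFlip u a b) g = wtPrefix u g := by
  intro g
  induction g with
  | zero => intro _ _; rw [wtPrefix_zero, wtPrefix_zero]
  | succ g ih =>
    intro hga hgn
    have hg : g < n := by omega
    rw [wtPrefix_succ _ g hg, wtPrefix_succ _ g hg, ih (by omega) (by omega),
      blockFlip_out u a b ⟨g, hg⟩ (by simp; omega)]

/-- inside the block the two prefix weights add up to `2·P_a + (g − a)` -/
theorem prefix_mid {n : ℕ} (u : Fin n → Bool) (a b : ℕ) (hbn : b ≤ n) :
    ∀ k, a + k ≤ b → wtPrefix (blockFlip u a b) (a + k) + wtPrefix u (a + k) = 2 * wtPrefix u a + k := by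
  intro k
  induction k with
  | zero => intro h; rw [Nat.add_zero, prefix_left u a b a le_rfl (by omega)]; ring
  | succ k ih =>
    intro hk
    have hg : a + k < n := by omega
    have e := ih (by omega)
    rw [show a + (k + 1) = (a + k) + 1 by ring, wtPrefix_succ _ (a + k) hg, wtPrefix_succ _ (a + k) hg,
      blockFlip_in u a b ⟨a + k, hg⟩ (by simp) (by simp; omega)]
    have h1 := ite_not_add (u ⟨a + k, hg⟩)
    omega

/-- right of the block: `P'_g + 2 P_b = P_g + (b − a) + 2 P_a` -/
theorem prefix_right {n : ℕ} (u : Fin n → Bool) (a b : ℕ) (hab : a ≤ b) (hbn : b ≤ n) :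
    ∀ k, b + k ≤ n →
      wtPrefix (blockFlip u a b) (b + k) + 2 * wtPrefix u b = wtPrefix u (b + k) + (b - a) + 2 * wtPrefix u a := by
  intro k
  induction k with
  | zero =>
    intro _
    have e := prefix_mid u a b hbn (b - a) (by omega)
    rw [Nat.add_sub_cancel' hab] at e
    rw [Nat.add_zero]
    omega
  | succ k ih =>
    intro hk
    have hg : b + k < n := by omega
    have e := ih (by omega)
    rw [show b + (k + 1) = (b + k) + 1 by ring, wtPrefix_succ _ (b + k) hg, wtPrefix_succ _ (b + k) hg,
      blockFlip_out u a b ⟨b + k, hg⟩ (by simp)]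
    omega

/-- **The block-flip lemma holds** (Lemma Q of ROUND-21 §1). -/
theorem blockFlipLabels_holds : BlockFlipLabels := by
  intro n c u a b hab hbn ha hb
  have han : a ≤ n := le_trans hab.le hbn
  have e3 : ∀ g, b ≤ g → g ≤ n →
      wtPrefix (blockFlip u a b) g + 2 * wtPrefix u b = wtPrefix u g + (b - a) + 2 * wtPrefix u a := by
    intro g h1 h2
    have := prefix_right u a b hab.le hbn (g - b) (by omega)
    rwa [Nat.add_sub_cancel' h1] at this
  have e2 : ∀ g, a ≤ g → g ≤ b →
      wtPrefix (blockFlip u a b) g + wtPrefix u g = 2 * wtPrefix u a + (g - a) := by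
    intro g h1 h2
    have := prefix_mid u a b hbn (g - a) (by omega)
    rwa [Nat.add_sub_cancel' h1] at this
  have e3n := e3 n hbn le_rfl
  unfold label walkExp at ha hb
  rw [wt_eq_wtPrefix, natCast_zmod3_eq_zero_iff] at ha hb
  refine ⟨?_, ?_⟩
  · intro g hg
    unfold label walkExp
    rw [wt_eq_wtPrefix, wt_eq_wtPrefix, ZMod.natCast_eq_natCast_iff']
    rcases hg with hg | hg
    · have e1 := prefix_left u a b g hg (le_trans hg han)
      omega
    · by_cases hgn : g ≤ n
      · have eg := e3 g hg hgn
        omega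
      · -- beyond the last cut both prefix weights are the full weights
        have hfull : ∀ v : Fin n → Bool, wtPrefix v g = wtPrefix v n := by
          intro v; unfold wtPrefix; congr 1; ext i; simp only [Finset.mem_filter]; constructor
          · rintro ⟨hm, _, h2⟩; exact ⟨hm, i.isLt, h2⟩
          · rintro ⟨hm, _, h2⟩; exact ⟨hm, by omega, h2⟩
        rw [hfull, hfull u]
        omega
  · intro g h1 h2
    rw [eq_neg_iff_add_eq_zero]
    unfold label walkExp
    rw [wt_eq_wtPrefix, wt_eq_wtPrefix, ← Nat.cast_add, natCast_zmod3_eq_zero_iff]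
    have eg := e2 g h1 h2
    omega

/-- **The live set is invariant under complete-block flips** (unconditional). -/
theorem blockFlipLive_holds : BlockFlipLive := blockFlipLive_of_labels blockFlipLabels_holds

/-- **The game on a flipped input is the parity over the ORIGINAL live set** (unconditional). -/
theorem blockFlipWin_holds : BlockFlipWin := blockFlipWin_of_live blockFlipLive_holds

end Coset21

end Summit.QuantumAdvantage.AdviceFreeQNC0
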